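import Mathlib
import HarnessLib
import Summits.Ventures.LatticeQCDFlow.Exactness.SphereKickedProduct
import Summits.Ventures.LatticeQCDFlow.Exactness.SphereFamilyLeapfrog

/-!
# The `n`-step leapfrog of a sphere FAMILY with a coupled force is a kicked product in the product operator algebra `Πᵢ (Eᵢ →L Eᵢ)`

HONEST FRAMING: exact (Metropolis-corrected) sampling algorithms for lattice gauge theory;
figures of merit are autocorrelation/cost numbers at stated couplings and volumes; no
continuum-physics claim.

Venture `LatticeQCDFlow` (cell pub-lqcd), topic `Exactness`, FANOUT row 9 (eng-latcore; roadmap Step 1 FOR FAMILIES toward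
multi-step HMC on the `cpn_2d` sphere family, HOME/eng-latcore/HANDOFF.md GEN-19/20).  NEW WORK of the cell over the tree
(gen-19's `SphereBodyFrameLeapfrog.lean`: `isoFrame`, `bfKick`, `bfDrift`, `geodRotEquiv`, `isoFrame_bfDrift`;
`SphereKickedProduct.lean`: `geodGenNegL`, `isoSet`, `one_mem_isoSet`, `norm_le_one_of_mem_isoSet`,
`exp_geodGenNegL_mul_mem_isoSet`, `exists_opExp_defect`, `opFrame`, `opFrame_bfDrift`; gen-18's
`KickedProductTrajectory.lean`: `plfStep`, `PLFBounds`; gen-16's `SphereFamilyLeapfrog.lean`: `famKick`, `famDrift`,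
`famLeapfrogPerm`) and Mathlib (`Pi.normedRing` / `Pi.normedAlgebra` — the sup-norm product algebra;
`ContinuousLinearMap.pi`, `LinearIsometryEquiv.adjoint_eq_symm`); nothing is cited as a fact; no number.

THE POINT.  `SphereKickedProduct.lean` reads ONE sphere's body-frame leapfrog as gen-18's `plfStep` in `E →L E`.  The
`cpn_2d` phase space is a FAMILY of spheres whose sites are coupled through the force along the trajectory, so the
per-site reading does not factor — but it does not have to: the same dictionary works VERBATIM in the PRODUCT algebra
`𝔸 = Πᵢ (Eᵢ →L[ℝ] Eᵢ)` (sup norm), with the product momentum space `V = Πᵢ Eᵢ`, the block generator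
`J q = (−A(eᵢ, qᵢ))ᵢ`, the sitewise exponential `ex a = (exp aᵢ)ᵢ`, the product isometry set `T = Πᵢ isoSet` (`C = 1`),
and the COUPLED body-frame kick `G V = (c · Vᵢ (F((Vⱼ† eⱼ)ⱼ) i))ᵢ`.  Gen-18's standing hypotheses `PLFBounds` hold
(`plfBounds_sphereFamily`: `b = |c| b_F`, `K = |c|(b_F + K_F)` for a force bounded by `b_F` per site and `K_F`-Lipschitz
in the sup distance of configurations; the exponential's defect radius is the minimum of the sitewise radii), and the
family leapfrog of `SphereFamilyLeapfrog.lean` from `(e, p)` IS `plfStep` from `(1, p)` read through the sitewise frames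
(`famOpFrame_famBfLeapfrog_iterate` with `famIsoFrame_famBfLeapfrog_iterate`).  Consequently gen-18's two-point estimate
`plfTraj_fst_approx` applies to the coupled `n`-step trajectory of the whole family, uniformly in `n`.

* §1 frames: `famIsoFrame e (W, q) = ((Wᵢ eᵢ)ᵢ, (Wᵢ qᵢ)ᵢ)`, body-frame letters `famBfKick`, `famBfDrift`, `famBfLeapfrog`;
  `famIsoFrame_famBfKick / _famBfDrift / _famBfLeapfrog / _famBfLeapfrog_iterate` (intertwining with `famKick`,
  `famDrift`, `famLeapfrogPerm`, `famLeapfrogPerm ^ n`), `famIsoFrame_refl`.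
* §2 the algebra: `famJ`, `famEx`, `famIsoSet`, `famPosOf`, `famBodyKickOp`; `exists_famEx_defect`;
  **`plfBounds_sphereFamily`**.
* §3 the dictionary: `famOpFrame`, `famOpFrame_famBfKick / _famBfDrift`, **`famOpFrame_famBfLeapfrog`**,
  **`famOpFrame_famBfLeapfrog_iterate`**; `fst_famLeapfrogPerm_pow_eq` (the configuration after `n` steps from `(e, p)`
  is `((V_n p)ᵢ† eᵢ)ᵢ` with `V_n p = (plfStep^[n] (1, p)).1`).

NOT CLAIMED: the tangent readout / approximate dilation / covering for families (Step 2), the position law and the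
minorisation (Step 4), cap chaining (Step 5), constants, the `cpn_2d` theorem.
-/

noncomputable section

namespace Summit.Ventures.LatticeQCDFlow.Exactness

open NormedSpace Metric Function Set
open scoped InnerProductSpace NNReal

section Family

variable {ι : Type*} [Fintype ι] {k : ι → ℕ}

/-! ## §1 Sitewise frames and the body-frame letters of the family -/

/-- **The family frame map** through the base configuration `e`: `(W, q) ↦ ((Wᵢ eᵢ)ᵢ, (Wᵢ qᵢ)ᵢ)`. -/
def famIsoFrame (e : Π i, FamS k i) (w : (Π i, FamE k i ≃ₗᵢ[ℝ] FamE k i) × (Π i, FamE k i)) :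
    (Π i, FamS k i) × (Π i, FamE k i) :=
  (fun i => (isoFrame (e i) (w.1 i, w.2 i)).1, fun i => (isoFrame (e i) (w.1 i, w.2 i)).2)

omit [Fintype ι] in
/-- Components. -/
@[simp] theorem famIsoFrame_fst_coe (e : Π i, FamS k i) (w : (Π i, FamE k i ≃ₗᵢ[ℝ] FamE k i) × (Π i, FamE k i)) (i : ι) :
    ((famIsoFrame e w).1 i : FamE k i) = w.1 i (e i : FamE k i) := rfl

omit [Fintype ι] in
/-- Components. -/
@[simp] theorem famIsoFrame_snd (e : Π i, FamS k i) (w : (Π i, FamE k i ≃ₗᵢ[ℝ] FamE k i) × (Π i, FamE k i)) (i : ι) :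
    (famIsoFrame e w).2 i = w.1 i (w.2 i) := rfl

omit [Fintype ι] in
/-- From the identity frames the frame map is the identity: `famIsoFrame e (refl, p) = (e, p)`. -/
theorem famIsoFrame_refl (e : Π i, FamS k i) (p : Π i, FamE k i) :
    famIsoFrame e (fun i => LinearIsometryEquiv.refl ℝ (FamE k i), p) = (e, p) :=
  Prod.ext (funext fun _ => Subtype.ext rfl) (funext fun _ => rfl)

/-- **Body-frame coupled kick**: `qᵢ ← qᵢ + c · Wᵢ⁻¹ (F (W e) i)`. -/
def famBfKick (F : (Π i, FamS k i) → (Π i, FamE k i)) (c : ℝ) (e : Π i, FamS k i)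
    (w : (Π i, FamE k i ≃ₗᵢ[ℝ] FamE k i) × (Π i, FamE k i)) :
    (Π i, FamE k i ≃ₗᵢ[ℝ] FamE k i) × (Π i, FamE k i) :=
  (w.1, fun i => w.2 i + c • (w.1 i).symm (F (famIsoFrame e w).1 i))

/-- **Body-frame sitewise drift**: `Wᵢ ← Wᵢ ∘ e^{tA(eᵢ, qᵢ)}`, `q` unchanged. -/
def famBfDrift (t : ℝ) (e : Π i, FamS k i) (w : (Π i, FamE k i ≃ₗᵢ[ℝ] FamE k i) × (Π i, FamE k i)) :
    (Π i, FamE k i ≃ₗᵢ[ℝ] FamE k i) × (Π i, FamE k i) :=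
  (fun i => (geodRotEquiv (e i : FamE k i) (w.2 i) t).trans (w.1 i), w.2)

/-- **The body-frame leapfrog step of the family** `K(δ/2) D(δ) K(δ/2)`. -/
def famBfLeapfrog (e : Π i, FamS k i) (F : (Π i, FamS k i) → (Π i, FamE k i)) (δ : ℝ)
    (w : (Π i, FamE k i ≃ₗᵢ[ℝ] FamE k i) × (Π i, FamE k i)) :
    (Π i, FamE k i ≃ₗᵢ[ℝ] FamE k i) × (Π i, FamE k i) :=
  famBfKick F (δ / 2) e (famBfDrift δ e (famBfKick F (δ / 2) e w))

variable (e : Π i, FamS k i) (F : (Π i, FamS k i) → (Π i, FamE k i))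

omit [Fintype ι] in
/-- The kick is intertwined: `famIsoFrame (famBfKick (W, q)) = famKick (famIsoFrame (W, q))`. -/
theorem famIsoFrame_famBfKick (c : ℝ) (w : (Π i, FamE k i ≃ₗᵢ[ℝ] FamE k i) × (Π i, FamE k i)) :
    famIsoFrame e (famBfKick F c e w) = famKick F c (famIsoFrame e w) := by
  refine Prod.ext (funext fun i => Subtype.ext rfl) (funext fun i => ?_)
  simp [famIsoFrame, famBfKick, famKick, isoFrame, map_add, map_smul]

omit [Fintype ι] in
/-- The drift is intertwined (sitewise `isoFrame_bfDrift`). -/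
theorem famIsoFrame_famBfDrift (t : ℝ) (w : (Π i, FamE k i ≃ₗᵢ[ℝ] FamE k i) × (Π i, FamE k i)) :
    famIsoFrame e (famBfDrift t e w) = famDrift t (famIsoFrame e w) := by
  have h : ∀ i, isoFrame (e i) (bfDrift t (e i) (w.1 i, w.2 i)) = ambientDrift t (isoFrame (e i) (w.1 i, w.2 i)) :=
    fun i => isoFrame_bfDrift (e i) t (w.1 i, w.2 i)
  refine Prod.ext (funext fun i => ?_) (funext fun i => ?_)
  · change (isoFrame (e i) (bfDrift t (e i) (w.1 i, w.2 i))).1 = (ambientDrift t (isoFrame (e i) (w.1 i, w.2 i))).1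
    rw [h i]
  · change (isoFrame (e i) (bfDrift t (e i) (w.1 i, w.2 i))).2 = (ambientDrift t (isoFrame (e i) (w.1 i, w.2 i))).2
    rw [h i]

omit [Fintype ι] in
/-- **The family leapfrog step is intertwined with the body-frame step.** -/
theorem famIsoFrame_famBfLeapfrog (δ : ℝ) (w : (Π i, FamE k i ≃ₗᵢ[ℝ] FamE k i) × (Π i, FamE k i)) :
    famIsoFrame e (famBfLeapfrog e F δ w) = famLeapfrogPerm F δ (famIsoFrame e w) := by
  change famIsoFrame e (famBfKick F (δ / 2) e (famBfDrift δ e (famBfKick F (δ / 2) e w))) =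
    famKick F (δ / 2) (famDrift δ (famKick F (δ / 2) (famIsoFrame e w)))
  rw [famIsoFrame_famBfKick, famIsoFrame_famBfDrift, famIsoFrame_famBfKick]

omit [Fintype ι] in
/-- **`n` family leapfrog steps from `(W e, W q)` are `famIsoFrame` of `n` body-frame steps from `(W, q)`.** -/
theorem famIsoFrame_famBfLeapfrog_iterate (δ : ℝ) (n : ℕ) (w : (Π i, FamE k i ≃ₗᵢ[ℝ] FamE k i) × (Π i, FamE k i)) :
    famIsoFrame e ((famBfLeapfrog e F δ)^[n] w) = (famLeapfrogPerm F δ ^ n) (famIsoFrame e w) := by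
  rw [Equiv.Perm.coe_pow]
  exact (Semiconj.iterate_right (fun w => famIsoFrame_famBfLeapfrog e F δ w) n w)

/-! ## §2 The product operator algebra: generator, exponential, isometries, the coupled kick -/

/-- **The block generator** `J q = (−A(eᵢ, qᵢ))ᵢ`, a continuous linear map into the product algebra. -/
def famJ (e' : Π i, FamE k i) : (Π i, FamE k i) →L[ℝ] (Π i, (FamE k i →L[ℝ] FamE k i)) :=
  ContinuousLinearMap.pi fun i => (geodGenNegL (e' i)).comp (ContinuousLinearMap.proj i)

omit [Fintype ι] in
/-- Pointwise. -/
@[simp] theorem famJ_apply (e' : Π i, FamE k i) (q : Π i, FamE k i) (i : ι) : famJ e' q i = geodGenNegL (e' i) (q i) := rfl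

/-- **The sitewise exponential** `ex a = (exp aᵢ)ᵢ`. -/
def famEx (a : Π i, (FamE k i →L[ℝ] FamE k i)) : Π i, (FamE k i →L[ℝ] FamE k i) := fun i => exp (a i)

omit [Fintype ι] in
/-- Pointwise. -/
@[simp] theorem famEx_apply (a : Π i, (FamE k i →L[ℝ] FamE k i)) (i : ι) : famEx a i = exp (a i) := rfl

omit [Fintype ι] in
/-- `ex 0 = 1`. -/
theorem famEx_zero : famEx (0 : Π i, (FamE k i →L[ℝ] FamE k i)) = 1 := by
  funext i
  rw [famEx_apply, Pi.zero_apply, NormedSpace.exp_zero, Pi.one_apply]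

/-- **The product isometry set** `T = Πᵢ isoSet`. -/
def famIsoSet : Set (Π i, (FamE k i →L[ℝ] FamE k i)) := {V | ∀ i, V i ∈ isoSet}

omit [Fintype ι] in
/-- Membership. -/
theorem mem_famIsoSet {V : Π i, (FamE k i →L[ℝ] FamE k i)} : V ∈ famIsoSet ↔ ∀ i, V i ∈ isoSet := Iff.rfl

omit [Fintype ι] in
/-- `1 ∈ T`. -/
theorem one_mem_famIsoSet : (1 : Π i, (FamE k i →L[ℝ] FamE k i)) ∈ famIsoSet := fun _ => one_mem_isoSet

/-- `T` has sup norm `≤ 1`. -/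
theorem norm_le_one_of_mem_famIsoSet {V : Π i, (FamE k i →L[ℝ] FamE k i)} (hV : V ∈ famIsoSet) : ‖V‖ ≤ 1 :=
  (pi_norm_le_iff_of_nonneg zero_le_one).2 fun i => norm_le_one_of_mem_isoSet (hV i)

omit [Fintype ι] in
/-- `T` is stable under `W ↦ ex (J v) · W`. -/
theorem famEx_famJ_mul_mem (e' : Π i, FamE k i) (v : Π i, FamE k i) {V : Π i, (FamE k i →L[ℝ] FamE k i)}
    (hV : V ∈ famIsoSet) : famEx (famJ e' v) * V ∈ famIsoSet := fun i => by
  rw [Pi.mul_apply, famEx_apply, famJ_apply]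
  exact exp_geodGenNegL_mul_mem_isoSet (e' i) (v i) (hV i)

/-- An isometry of the algebra has isometric adjoint: `‖V† y‖ = ‖y‖` (finite dimension: `V` is onto, `V† = V⁻¹`). -/
theorem norm_adjoint_of_mem_isoSet {m : Type*} [Fintype m] {V : EuclideanSpace ℝ m →L[ℝ] EuclideanSpace ℝ m}
    (hV : V ∈ isoSet) (y : EuclideanSpace ℝ m) : ‖ContinuousLinearMap.adjoint V y‖ = ‖y‖ := by
  -- `V` as a linear isometry equivalence
  let L : EuclideanSpace ℝ m →ₗᵢ[ℝ] EuclideanSpace ℝ m := ⟨V, fun z => hV z⟩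
  let Le : EuclideanSpace ℝ m ≃ₗᵢ[ℝ] EuclideanSpace ℝ m := L.toLinearIsometryEquiv rfl
  have hLe : (Le : EuclideanSpace ℝ m →L[ℝ] EuclideanSpace ℝ m) = V := by
    refine ContinuousLinearMap.ext fun z => ?_
    rfl
  rw [← hLe, LinearIsometryEquiv.adjoint_eq_symm, LinearIsometryEquiv.coe_coe'', LinearIsometryEquiv.norm_map]

/-- **The configuration read off an element of the algebra**: site `i` sits at `Vᵢ† eᵢ` when that is a unit vector (always
the case on `T`), else (harmlessly) at `eᵢ`. -/
def famPosOf (e : Π i, FamS k i) (V : Π i, (FamE k i →L[ℝ] FamE k i)) : Π i, FamS k i := fun i =>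
  if h : ‖ContinuousLinearMap.adjoint (V i) (e i : FamE k i)‖ = 1 then
    ⟨ContinuousLinearMap.adjoint (V i) (e i : FamE k i), mem_sphere_zero_iff_norm.2 h⟩ else e i

omit [Fintype ι] in
/-- On `T` the read-off configuration is `(Vᵢ† eᵢ)ᵢ`. -/
theorem coe_famPosOf_of_mem {V : Π i, (FamE k i →L[ℝ] FamE k i)} (hV : V ∈ famIsoSet) (i : ι) :
    (famPosOf e V i : FamE k i) = ContinuousLinearMap.adjoint (V i) (e i : FamE k i) := by
  have h : ‖ContinuousLinearMap.adjoint (V i) (e i : FamE k i)‖ = 1 := by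
    rw [norm_adjoint_of_mem_isoSet (hV i), norm_eq_of_mem_sphere (e i)]
  simp only [famPosOf, dif_pos h]

/-- **The coupled body-frame kick read in the algebra**: `G V = (c · Vᵢ (F (pos V) i))ᵢ`. -/
def famBodyKickOp (c : ℝ) (V : Π i, (FamE k i →L[ℝ] FamE k i)) : Π i, FamE k i :=
  fun i => c • (V i) (F (famPosOf e V) i)

variable {e F} {bF KF : ℝ}

/-- `‖G V‖ ≤ |c| b_F` on `T` (`b_F ≥ 0`). -/
theorem norm_famBodyKickOp_le (hb0 : 0 ≤ bF) (hFb : ∀ x i, ‖F x i‖ ≤ bF) (c : ℝ) {V : Π i, (FamE k i →L[ℝ] FamE k i)}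
    (hV : V ∈ famIsoSet) : ‖famBodyKickOp e F c V‖ ≤ |c| * bF := by
  refine (pi_norm_le_iff_of_nonneg (by positivity)).2 fun i => ?_
  change ‖c • (V i) (F (famPosOf e V) i)‖ ≤ |c| * bF
  rw [norm_smul, Real.norm_eq_abs, (hV i) _]
  exact mul_le_mul_of_nonneg_left (hFb _ i) (abs_nonneg c)

/-- `G` is Lipschitz on `T` in the sup operator norm, constant `|c| (b_F + K_F)`, for a force `K_F`-Lipschitz in the sup
distance of configurations. -/
theorem famBodyKickOp_lipschitz (hb0 : 0 ≤ bF) (hFb : ∀ x i, ‖F x i‖ ≤ bF) (hK0 : 0 ≤ KF)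
    (hFK : ∀ (x x' : Π i, FamS k i) (M : ℝ), (∀ j, ‖(x j : FamE k j) - (x' j : FamE k j)‖ ≤ M) →
      ∀ i, ‖F x i - F x' i‖ ≤ KF * M)
    (c : ℝ) {V V' : Π i, (FamE k i →L[ℝ] FamE k i)} (hV : V ∈ famIsoSet) (hV' : V' ∈ famIsoSet) :
    ‖famBodyKickOp e F c V - famBodyKickOp e F c V'‖ ≤ |c| * (bF + KF) * ‖V - V'‖ := by
  -- positions move by at most `‖V − V'‖`
  have hpos : ∀ j, ‖(famPosOf e V j : FamE k j) - (famPosOf e V' j : FamE k j)‖ ≤ ‖V - V'‖ := fun j => by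
    have hsub : ContinuousLinearMap.adjoint (V j) (e j : FamE k j) - ContinuousLinearMap.adjoint (V' j) (e j : FamE k j) =
        ContinuousLinearMap.adjoint (V j - V' j) (e j : FamE k j) := by
      rw [map_sub]; rfl
    rw [coe_famPosOf_of_mem e hV, coe_famPosOf_of_mem e hV', hsub]
    calc ‖ContinuousLinearMap.adjoint (V j - V' j) (e j : FamE k j)‖
        ≤ ‖ContinuousLinearMap.adjoint (V j - V' j)‖ * ‖(e j : FamE k j)‖ := ContinuousLinearMap.le_opNorm _ _
      _ = ‖V j - V' j‖ := by rw [LinearIsometryEquiv.norm_map, norm_eq_of_mem_sphere (e j), mul_one]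
      _ ≤ ‖V - V'‖ := by rw [← Pi.sub_apply]; exact norm_le_pi_norm _ j
  refine (pi_norm_le_iff_of_nonneg (by positivity)).2 fun i => ?_
  change ‖c • (V i) (F (famPosOf e V) i) - c • (V' i) (F (famPosOf e V') i)‖ ≤ |c| * (bF + KF) * ‖V - V'‖
  have h1 : ‖(V i) (F (famPosOf e V) i) - (V' i) (F (famPosOf e V') i)‖ ≤ (bF + KF) * ‖V - V'‖ := by
    calc ‖(V i) (F (famPosOf e V) i) - (V' i) (F (famPosOf e V') i)‖
        = ‖(V i - V' i) (F (famPosOf e V) i) + (V' i) (F (famPosOf e V) i - F (famPosOf e V') i)‖ := by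
          congr 1
          rw [map_sub, show (V i - V' i) (F (famPosOf e V) i) = (V i) (F (famPosOf e V) i) - (V' i) (F (famPosOf e V) i)
            from rfl]
          abel
      _ ≤ ‖(V i - V' i) (F (famPosOf e V) i)‖ + ‖(V' i) (F (famPosOf e V) i - F (famPosOf e V') i)‖ := norm_add_le _ _
      _ ≤ ‖V i - V' i‖ * bF + KF * ‖V - V'‖ := by
          refine add_le_add ((ContinuousLinearMap.le_opNorm _ _).trans
            (mul_le_mul_of_nonneg_left (hFb _ i) (norm_nonneg _))) ?_
          rw [(hV' i) _]
          exact hFK _ _ _ hpos i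
      _ ≤ ‖V - V'‖ * bF + KF * ‖V - V'‖ := by
          gcongr
          rw [← Pi.sub_apply]; exact norm_le_pi_norm _ i
      _ = (bF + KF) * ‖V - V'‖ := by ring
  rw [← smul_sub, norm_smul, Real.norm_eq_abs, mul_assoc]
  exact mul_le_mul_of_nonneg_left h1 (abs_nonneg c)

/-- **The sitewise exponential has the `η`-defect property near `0` in the sup norm** for every `η > 0` (the minimum of
the sitewise radii of `exists_opExp_defect`). -/
theorem exists_famEx_defect {η : ℝ} (hη : 0 < η) :
    ∃ ρ : ℝ, 0 < ρ ∧ ∀ a a' : Π i, (FamE k i →L[ℝ] FamE k i), ‖a‖ ≤ ρ → ‖a'‖ ≤ ρ →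
      ‖famEx a - famEx a' - (a - a')‖ ≤ η * ‖a - a'‖ := by
  classical
  choose ρ hρ hdef using fun i => exists_opExp_defect (m := Fin (k i + 2)) hη
  rcases isEmpty_or_nonempty ι with hι | hι
  · refine ⟨1, one_pos, fun a a' _ _ => ?_⟩
    have h0 : famEx a - famEx a' - (a - a') = 0 := funext fun i => (hι.false i).elim
    rw [h0, norm_zero]; positivity
  · refine ⟨Finset.univ.inf' Finset.univ_nonempty ρ, (Finset.lt_inf'_iff _).2 fun i _ => hρ i, fun a a' ha ha' => ?_⟩
    refine (pi_norm_le_iff_of_nonneg (by positivity)).2 fun i => ?_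
    have hρi : Finset.univ.inf' Finset.univ_nonempty ρ ≤ ρ i := Finset.inf'_le _ (Finset.mem_univ i)
    have hai : ‖a i‖ ≤ ρ i := ((norm_le_pi_norm a i).trans ha).trans hρi
    have hai' : ‖a' i‖ ≤ ρ i := ((norm_le_pi_norm a' i).trans ha').trans hρi
    calc ‖(famEx a - famEx a' - (a - a')) i‖ = ‖exp (a i) - exp (a' i) - (a i - a' i)‖ := rfl
      _ ≤ η * ‖a i - a' i‖ := hdef i _ _ hai hai'
      _ ≤ η * ‖a - a'‖ := by
          refine mul_le_mul_of_nonneg_left ?_ hη.le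
          rw [← Pi.sub_apply]; exact norm_le_pi_norm _ i

/-- **THE STANDING HYPOTHESES OF THE KICKED-PRODUCT ANALYSIS HOLD FOR THE COUPLED FAMILY LEAPFROG**: `T = Πᵢ isoSet`,
`C = 1`, the coupled body-frame kick bounded by `|c| b_F` and Lipschitz with constant `|c|(b_F + K_F)`, the sitewise
exponential with defect `η` on the sup-norm ball of radius `ρ`. -/
theorem plfBounds_sphereFamily (hb0 : 0 ≤ bF) (hFb : ∀ x i, ‖F x i‖ ≤ bF) (hK0 : 0 ≤ KF)
    (hFK : ∀ (x x' : Π i, FamS k i) (M : ℝ), (∀ j, ‖(x j : FamE k j) - (x' j : FamE k j)‖ ≤ M) →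
      ∀ i, ‖F x i - F x' i‖ ≤ KF * M)
    (c : ℝ) {ρ η : ℝ} (hρ : 0 < ρ) (hη0 : 0 ≤ η) (hη1 : η ≤ 1)
    (hdef : ∀ a a' : Π i, (FamE k i →L[ℝ] FamE k i), ‖a‖ ≤ ρ → ‖a'‖ ≤ ρ →
      ‖famEx a - famEx a' - (a - a')‖ ≤ η * ‖a - a'‖) :
    PLFBounds famEx (famJ fun i => (e i : FamE k i)) (famBodyKickOp e F c) famIsoSet 1 (|c| * bF) (|c| * (bF + KF)) ρ η where
  one_mem := one_mem_famIsoSet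
  mul_mem := fun v V hV => famEx_famJ_mul_mem _ v hV
  norm_le := fun V hV => norm_le_one_of_mem_famIsoSet hV
  one_le := le_rfl
  force_le := fun V hV => norm_famBodyKickOp_le hb0 hFb c hV
  force_lip := fun V hV V' hV' => famBodyKickOp_lipschitz hb0 hFb hK0 hFK c hV hV'
  lip_nonneg := by positivity
  ex_zero := famEx_zero
  ex_defect := hdef
  defect_nonneg := hη0
  defect_le_one := hη1
  radius_nonneg := hρ.le

/-! ## §3 The dictionary: inverse frames follow `plfStep` in the product algebra -/

variable (e F)

/-- **The inverse frames read in the product algebra**: `(W, q) ↦ ((Wᵢ⁻¹)ᵢ as continuous linear maps, q)`. -/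
def famOpFrame (w : (Π i, FamE k i ≃ₗᵢ[ℝ] FamE k i) × (Π i, FamE k i)) :
    (Π i, (FamE k i →L[ℝ] FamE k i)) × (Π i, FamE k i) :=
  (fun i => ((w.1 i).symm : FamE k i →L[ℝ] FamE k i), w.2)

omit [Fintype ι] in
/-- Sitewise it is `opFrame`. -/
theorem famOpFrame_apply (w : (Π i, FamE k i ≃ₗᵢ[ℝ] FamE k i) × (Π i, FamE k i)) (i : ι) :
    ((famOpFrame w).1 i, (famOpFrame w).2 i) = opFrame (w.1 i, w.2 i) := rfl

omit [Fintype ι] in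
/-- The identity frames read as `1`. -/
theorem famOpFrame_refl (p : Π i, FamE k i) :
    famOpFrame (fun i => LinearIsometryEquiv.refl ℝ (FamE k i), p) = (1, p) :=
  Prod.ext (funext fun _ => ContinuousLinearMap.ext fun _ => rfl) rfl

omit [Fintype ι] in
/-- Inverse frames are isometries: `famOpFrame` lands in `T`. -/
theorem famOpFrame_fst_mem (w : (Π i, FamE k i ≃ₗᵢ[ℝ] FamE k i) × (Π i, FamE k i)) : (famOpFrame w).1 ∈ famIsoSet :=
  fun i y => (w.1 i).symm.norm_map y

omit [Fintype ι] in
/-- The configuration read off the inverse frames is the frame configuration: `pos (W⁻¹) = W e`. -/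
theorem famPosOf_famOpFrame (w : (Π i, FamE k i ≃ₗᵢ[ℝ] FamE k i) × (Π i, FamE k i)) :
    famPosOf e (famOpFrame w).1 = (famIsoFrame e w).1 := by
  funext i
  apply Subtype.ext
  rw [coe_famPosOf_of_mem e (famOpFrame_fst_mem w), famIsoFrame_fst_coe]
  change ContinuousLinearMap.adjoint ((w.1 i).symm : FamE k i →L[ℝ] FamE k i) (e i : FamE k i) = w.1 i (e i : FamE k i)
  rw [LinearIsometryEquiv.adjoint_eq_symm, LinearIsometryEquiv.symm_symm]
  rfl

omit [Fintype ι] in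
/-- The kick in the algebra: `famOpFrame (famBfKick (W, q)) = (V, q + G V)`. -/
theorem famOpFrame_famBfKick (c : ℝ) (w : (Π i, FamE k i ≃ₗᵢ[ℝ] FamE k i) × (Π i, FamE k i)) :
    famOpFrame (famBfKick F c e w) = ((famOpFrame w).1, (famOpFrame w).2 + famBodyKickOp e F c (famOpFrame w).1) := by
  refine Prod.ext rfl (funext fun i => ?_)
  change w.2 i + c • (w.1 i).symm (F (famIsoFrame e w).1 i) = w.2 i + c • ((w.1 i).symm : FamE k i →L[ℝ] FamE k i) (F (famPosOf e (famOpFrame w).1) i)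
  rw [famPosOf_famOpFrame]
  rfl

omit [Fintype ι] in
/-- The drift in the algebra: `famOpFrame (famBfDrift δ (W, q)) = (ex (δ • J q) * V, q)`. -/
theorem famOpFrame_famBfDrift (δ : ℝ) (w : (Π i, FamE k i ≃ₗᵢ[ℝ] FamE k i) × (Π i, FamE k i)) :
    famOpFrame (famBfDrift δ e w) =
      (famEx (δ • famJ (fun i => (e i : FamE k i)) (famOpFrame w).2) * (famOpFrame w).1, (famOpFrame w).2) := by
  refine Prod.ext (funext fun i => ?_) rfl
  have h := congrArg Prod.fst (opFrame_bfDrift (e i) δ (w.1 i, w.2 i))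
  simp only [opFrame, bfDrift] at h
  change (((geodRotEquiv (e i : FamE k i) (w.2 i) δ).trans (w.1 i)).symm : FamE k i →L[ℝ] FamE k i) =
    (famEx (δ • famJ (fun i => (e i : FamE k i)) w.2) * fun i => ((w.1 i).symm : FamE k i →L[ℝ] FamE k i)) i
  rw [Pi.mul_apply, famEx_apply, Pi.smul_apply, famJ_apply]
  exact h

/-- **THE FAMILY LEAPFROG STEP IS gen-18's `plfStep` IN THE PRODUCT ALGEBRA**:
`famOpFrame ∘ famBfLeapfrog e F δ = plfStep ex J G δ ∘ famOpFrame` with `G = famBodyKickOp e F (δ/2)`. -/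
theorem famOpFrame_famBfLeapfrog (δ : ℝ) (w : (Π i, FamE k i ≃ₗᵢ[ℝ] FamE k i) × (Π i, FamE k i)) :
    famOpFrame (famBfLeapfrog e F δ w) =
      plfStep famEx (famJ fun i => (e i : FamE k i)) (famBodyKickOp e F (δ / 2)) δ (famOpFrame w) := by
  rw [famBfLeapfrog, famOpFrame_famBfKick, famOpFrame_famBfDrift, famOpFrame_famBfKick, plfStep]

/-- **`n` family leapfrog steps from the identity frames are `n` steps of `plfStep` from `(1, p)`.** -/
theorem famOpFrame_famBfLeapfrog_iterate (δ : ℝ) (p : Π i, FamE k i) (n : ℕ) :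
    famOpFrame ((famBfLeapfrog e F δ)^[n] (fun i => LinearIsometryEquiv.refl ℝ (FamE k i), p)) =
      (plfStep famEx (famJ fun i => (e i : FamE k i)) (famBodyKickOp e F (δ / 2)) δ)^[n] (1, p) := by
  have h : Semiconj famOpFrame (famBfLeapfrog e F δ)
      (plfStep famEx (famJ fun i => (e i : FamE k i)) (famBodyKickOp e F (δ / 2)) δ) :=
    fun w => famOpFrame_famBfLeapfrog e F δ w
  rw [(h.iterate_right n).eq, famOpFrame_refl]

/-- **THE CONFIGURATION AFTER `n` STEPS FROM `(e, p)` IS `((V_n)ᵢ† eᵢ)ᵢ`** with `V_n = (plfStep^[n] (1, p)).1` the inverse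
frames in the product algebra. -/
theorem fst_famLeapfrogPerm_pow_eq (δ : ℝ) (p : Π i, FamE k i) (n : ℕ) (i : ι) :
    (((famLeapfrogPerm F δ ^ n) (e, p)).1 i : FamE k i) =
      ContinuousLinearMap.adjoint
        (((plfStep famEx (famJ fun i => (e i : FamE k i)) (famBodyKickOp e F (δ / 2)) δ)^[n] (1, p)).1 i) (e i : FamE k i) := by
  rw [← famOpFrame_famBfLeapfrog_iterate, ← famIsoFrame_refl e p, ← famIsoFrame_famBfLeapfrog_iterate,
    ← coe_famPosOf_of_mem e (famOpFrame_fst_mem _), famPosOf_famOpFrame]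

end Family

end Summit.Ventures.LatticeQCDFlow.Exactness

end
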